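import Literature.AlgebraicGeometry.HodgeTheory.MaxRationalSubHodgeStructureGysinImages
import HarnessLib

/-!
# `GHC` reduces to the middle degree: `GHC(X × ℙˢ, n + s, r + s) ⟹ GHC(X, n − s, r)` (products with
# projective spaces) and, with hard Lefschetz, `GHC` in the middle degree of every smooth projective variety
# implies `GHC` in every bidegree

Family `hodge`, layer `Literature/AlgebraicGeometry/HodgeTheory`; lane `lit-hodgefound` (Track 2 foundations,
Layer A1/A4). THEOREMS ONLY (no definition, no named fact; D-0026).

Voisin (J. Open Math. Probl. 1 (2025), §4.3, PDF p. 27): «In order to solve the generalized Hodge conjecture for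
`L`, we can assume that `k ≤ n = dim X`, by the hard Lefschetz isomorphism.» — the tree's
`forall_generalHodgePropertyFor_iff_lower_window` (`MaxRationalSubHodgeStructureHardLefschetz`). Below the middle
the product device of Brosnan–Fang–Nie–Pearlstein (Invent. Math. 177 (2009), §6, proof of Lemma 48, for Hodge
classes: «set `X = Y × ℙ^{2k − dim Y}` and let `β = pr₁^* α` […] by the projection formula, `α ∪ pr_{1*}[Z] ≠ 0`»)
works verbatim for Grothendieck's amended `GHC`, and — unlike the Hodge-class version, which needs the lifting
of Hodge classes along Gysin morphisms (the tree's `MiddleDimensionReduction*`, Voisin 2025 Cor. 2.12) — needs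
no input beyond the functoriality of admissible subspaces under Gysin morphisms (the tree's
`MaxRationalSubHodgeStructureGysinImages`, `MaxRationalSubHodgeStructureFunctoriality`):

for `k + s = n` and a complex point `t` of `ℙˢ`, the slice `i_t = (𝟙, t) : X ⟶ X × ℙˢ` (`Motives.sliceAt`) and
the projection `pr₁` satisfy `pr_{1*} ∘ i_{t*} = 𝟙` on `Hᵏ(X(ℂ); ℂ)` (`complexGysin_comp`, `complexGysin_id`,
`sliceAt_fst`); `i_{t*}` maps `max_X(k, r)` into `max_{X×ℙˢ}(k + 2s, r + s)` (bidegree `(s, s)`: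
`HodgeModel.map_complexGysin_maxRatSubHodgeInFilt_le_of_add_eq_dim`), which `GHC(X × ℙˢ, k + 2s = n + s, r + s)`
— the MIDDLE degree of the `(n+s)`-fold `X × ℙˢ` — puts inside `N^{r+s} H^{n+s}((X × ℙˢ)(ℂ); ℂ)`; and `pr_{1*}`
maps `N^{r+s} H^{k+2s}` into `Nʳ Hᵏ(X(ℂ); ℂ)` (`complexGysin_mem_supportedClasses`, the proved support property
of Gysin maps). Hence `max_X(k, r) ≤ Nʳ Hᵏ`, i.e. `GHC(X, k, r)`.

* §1 **`generalHodgePropertyFor_of_tensor_projectiveSpace`** — `GHC(X × ℙˢ, n + s, r + s) ⟹ GHC(X, k, r)` for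
  `k + s = n`.
* §2 **`generalHodgePropertyFor_of_middle_of_le`** (`k ≤ n`: `GHC` in the middle degree of all smooth projective
  varieties ⟹ `GHC(X, k, r)`), **`forall_generalHodgePropertyFor_of_middle`** (all `(i, r)`, the degrees above
  the middle by hard Lefschetz) and **`forall_generalHodgePropertyFor_iff_middle`**: Grothendieck's general
  Hodge conjecture for all smooth projective complex varieties in all bidegrees is EQUIVALENT to its middle-degree
  case `GHC(Y, dim Y, r)` for all smooth projective `Y` and all `r`.

## References

* [Voisin2025] C. Voisin, Hodge and generalized Hodge conjectures, coniveau and algebraic cycles, J. Open Math.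
  Probl. 1 (2025), §4.3 (PDF p. 27).
* [BrosnanFangNiePearlstein2009] P. Brosnan, H. Fang, Z. Nie, G. Pearlstein, Singularities of admissible normal
  functions, Invent. Math. 177 (2009), §6 Lemma 48 (proof, case `dim Y < 2k`).
* [GrothendieckTopology1969] A. Grothendieck, Hodge's general conjecture is false for trivial reasons, Topology 8
  (1969), p. 300.
* [FultonYoungTableaux1997] W. Fulton, Young Tableaux, CUP 1997, App. B §B.1 (5) (functoriality of Gysin maps).
-/

noncomputable section

open CategoryTheory CategoryTheory.Limits AlgebraicGeometry MonoidalCategory CartesianMonoidalCategory Module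
open Literature.AlgebraicTopology.SingularHomology
open Literature.Geometry.Kaehler
open Literature.AlgebraicGeometry.Motives (IsSmoothProjective ComplexPoints)

namespace Literature.AlgebraicGeometry.HodgeTheory

variable {n : ℕ} {X : Motives.SchemeOver ℂ}

/-! ### §1 The product step: `GHC(X × ℙˢ, n + s, r + s) ⟹ GHC(X, n − s, r)` -/

/-- **`GHC(X × ℙˢ, n + s, r + s) ⟹ GHC(X, k, r)` for `k + s = n`** — the middle degree of the `(n+s)`-fold
`X × ℙˢ` governs degree `k = n − s` on `X`: for a slice `i_t : X ⟶ X × ℙˢ`, `i_{t*} max_X(k, r) ≤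
max_{X×ℙˢ}(k + 2s, r + s) ≤ N^{r+s} H^{k+2s}((X × ℙˢ)(ℂ); ℂ)` (the hypothesis, `k + 2s = n + s`), and
`pr_{1*}` brings this back into `Nʳ Hᵏ(X(ℂ); ℂ)` with `pr_{1*} i_{t*} = 𝟙`.
[cite: BrosnanFangNiePearlstein2009, §6 Lemma 48 (proof, case dim Y < 2k)] [cite: Voisin2025, §4.3]
[cite: FultonYoungTableaux1997, Appendix B §B.1 (5)] -/
theorem generalHodgePropertyFor_of_tensor_projectiveSpace (hX : IsSmoothProjective n X) {k s : ℕ}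
    (hs : k + s = n) {r : ℕ}
    (h : GeneralHodgePropertyFor (n + s) (X ⊗ Motives.projectiveSpace s ℂ) (n + s) (r + s)) :
    GeneralHodgePropertyFor n X k r := by
  classical
  -- the auxiliary factor `P = ℙˢ_ℂ`, a complex point `t` of it, and the smooth projective `X × P`
  set P := Motives.projectiveSpace s ℂ with hPdef
  have hP : IsSmoothProjective s P := Motives.isSmoothProjective_projectiveSpace_holds ℂ s
  haveI := connectedSpace_complexPoints hP
  obtain ⟨t⟩ : Nonempty (ComplexPoints P) := inferInstance
  have hXP : IsSmoothProjective (n + s) (X ⊗ P) := Motives.IsSmoothProjective.tensor_holds hX hP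
  obtain ⟨A⟩ := nonempty_hodgeModel_holds (n := n) (X := X) hX
  obtain ⟨B⟩ := nonempty_hodgeModel_holds (n := n + s) (X := X ⊗ P) hXP
  refine (generalHodgePropertyFor_iff_of_hodgeModel A hX k r).2 fun x hx ↦ ?_
  -- the Gysin morphisms of the slice `i_t` and of `pr₁`, with `pr_{1*} ∘ i_{t*} = 𝟙`
  have hsl : k + 2 * (n + s) = (k + 2 * s) + 2 * n := by ring
  have hab : (k + 2 * s) + 2 * n = k + 2 * (n + s) := by ring
  have hcomp := complexGysin_comp hasPoincareDuality_complexOrientationFamily hX hXP hX (Motives.sliceAt X t)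
    (fst X P) hsl hab
  rw [Motives.sliceAt_fst, complexGysin_id hasPoincareDuality_complexOrientationFamily hX] at hcomp
  -- `i_{t*} x ∈ max_{X × P}(k + 2s, r + s)`
  have h₁ : complexGysin complexOrientationFamily hX hXP (Motives.sliceAt X t) hsl x ∈
      B.maxRatSubHodgeInFilt (k + 2 * s) (r + s) :=
    A.map_complexGysin_maxRatSubHodgeInFilt_le_of_add_eq_dim B hX hXP (Motives.sliceAt X t) rfl hsl r
      ⟨x, hx, rfl⟩
  -- `GHC` in the middle degree `k + 2s = n + s` of `X × P`
  have hG : GeneralHodgePropertyFor (n + s) (X ⊗ P) (k + 2 * s) (r + s) := by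
    rw [show k + 2 * s = n + s by omega]
    exact h
  have h₂ : complexGysin complexOrientationFamily hX hXP (Motives.sliceAt X t) hsl x ∈
      supportedClasses (X ⊗ P) (k + 2 * s) (r + s) :=
    (generalHodgePropertyFor_iff_of_hodgeModel B hXP _ _).1 hG h₁
  -- push forward by `pr₁`
  have h₃ := complexGysin_mem_supportedClasses (gysinMap_restrictCompl_eq_zero_of_field ℂ)
    complexOrientationFamily hasPoincareDuality_complexOrientationFamily hXP hX (fst X P) hab (r := r + s)
    (s := r) (by omega) h₂
  have hx' : x = complexGysin complexOrientationFamily hXP hX (fst X P) hab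
      (complexGysin complexOrientationFamily hX hXP (Motives.sliceAt X t) hsl x) := by
    rw [← LinearMap.comp_apply, ← hcomp, LinearMap.id_apply]
  rw [hx']
  exact h₃

/-! ### §2 `GHC` in the middle degree of all smooth projective varieties implies `GHC` in all bidegrees -/

/-- **Below the middle: if `GHC(Y, dim Y, r')` holds for every smooth projective complex `Y` and every `r'`, then
`GHC(X, k, r)` holds for all `k ≤ dim X`** (§1 with `Y = X × ℙ^{n−k}`, `r' = r + n − k`).
[cite: BrosnanFangNiePearlstein2009, §6 Lemma 48] [cite: Voisin2025, §4.3] -/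
theorem generalHodgePropertyFor_of_middle_of_le
    (hmid : ∀ (m : ℕ) (Y : Motives.SchemeOver ℂ), IsSmoothProjective m Y → ∀ r : ℕ, GeneralHodgePropertyFor m Y m r)
    (hX : IsSmoothProjective n X) {k : ℕ} (hk : k ≤ n) (r : ℕ) : GeneralHodgePropertyFor n X k r := by
  obtain ⟨s, hs⟩ : ∃ s, k + s = n := ⟨n - k, by omega⟩
  exact generalHodgePropertyFor_of_tensor_projectiveSpace hX hs (hmid (n + s) _
    (Motives.IsSmoothProjective.tensor_holds hX (Motives.isSmoothProjective_projectiveSpace_holds ℂ s)) (r + s))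

/-- **`GHC` in the middle degree of all smooth projective complex varieties implies `GHC(X, i, r)` for ALL
`(i, r)`**: degrees `i ≤ dim X` by products with projective spaces (§1), degrees above the middle by hard
Lefschetz (the tree's `forall_generalHodgePropertyFor_iff_lower_window`: «we can assume that `k ≤ n = dim X`, by
the hard Lefschetz isomorphism»). [cite: Voisin2025, §4.3] [cite: BrosnanFangNiePearlstein2009, §6 Lemma 48] -/
theorem forall_generalHodgePropertyFor_of_middle
    (hmid : ∀ (m : ℕ) (Y : Motives.SchemeOver ℂ), IsSmoothProjective m Y → ∀ r : ℕ, GeneralHodgePropertyFor m Y m r)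
    (hX : IsSmoothProjective n X) (i r : ℕ) : GeneralHodgePropertyFor n X i r :=
  (forall_generalHodgePropertyFor_iff_lower_window hX).2
    (fun _ r _ _ hi _ ↦ generalHodgePropertyFor_of_middle_of_le hmid hX hi r) i r

/-- **GROTHENDIECK'S GENERAL HODGE CONJECTURE IS EQUIVALENT TO ITS MIDDLE-DEGREE CASE**: `GHC(Y, i, r)` for all
smooth projective complex `Y` and all `(i, r)` iff `GHC(Y, dim Y, r)` for all such `Y` and all `r`.
[cite: Voisin2025, §4.3] [cite: BrosnanFangNiePearlstein2009, §6 Lemma 48] [cite: GrothendieckTopology1969, p. 300] -/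
theorem forall_generalHodgePropertyFor_iff_middle :
    (∀ (m : ℕ) (Y : Motives.SchemeOver ℂ), IsSmoothProjective m Y → ∀ i r : ℕ, GeneralHodgePropertyFor m Y i r) ↔
      ∀ (m : ℕ) (Y : Motives.SchemeOver ℂ), IsSmoothProjective m Y → ∀ r : ℕ, GeneralHodgePropertyFor m Y m r :=
  ⟨fun h m Y hY r ↦ h m Y hY m r, fun h _ _ hY i r ↦ forall_generalHodgePropertyFor_of_middle h hY i r⟩

end Literature.AlgebraicGeometry.HodgeTheory

end
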